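import Literature.NumberTheory.EllipticCurves.ComplexMultiplicationShaProofs
import Literature.NumberTheory.EllipticCurves.ShaTorsion
import HarnessLib

/-!
# bsd.S28 (Rubin): level 2 of the decomposition — Theorem A from Theorem 6.6 and the
`𝔭`-primary finiteness of §10

Second sibling proof file for `Literature.NumberTheory.EllipticCurves.shaFinite_of_hasCM_of_L_one_ne_zero` (**bsd.S28**, `Ш`
part). Level 1 (`ComplexMultiplicationShaProofs.lean`) reduced the target, sorry-free, to Rubin's
**Theorem A** over the CM field, vendored as `Literature.NumberTheory.EllipticCurves.Rubin1987_shaFinite_baseChange_cmField`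
(`L(E_K/K, 1) ≠ 0 ⇒ Ш(E_K/K)` finite, for the base change `E_K` of a CM curve `E/ℚ` with CM by
`𝓞_K` to its CM field `K`). This file performs the next step *of the printed proof* — the first
paragraph of §10, "Proof of Theorem A" (Invent. Math. 89 (1987), p. 549):

> *"Since `Ш` is a torsion group, in light of Theorem 6.6 we only need to show that if
> `L(ψ̄, 1) ≠ 0` then `Ш_{𝔭^∞}` is finite for every `𝔭`. Since `Ш_{𝔭ⁿ}` is finite … it is enough
> to show that the exponent of `Ш_{𝔭ⁿ}` is bounded independent of `n`. If `L(ψ̄, 1) ≠ 0`,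
> Theorem 6.1 shows that the exponent of `𝔅_n` is bounded independent of `n`, and Theorem 8.1
> (for `𝔭 ∤ w_K 𝔣`) or Theorem 9.1 (for `𝔭 ∣ w_K`) shows that the exponent of
> `Hom(A_n, E_{𝔭ⁿ})^{G_n}` is bounded independent of `n`. Therefore by Theorem 1.9 and Lemma 2.2,
> the exponent of `S'(𝔭ⁿ)` is bounded independent of `n`, and by (1.2) the same is true for
> `Ш_{𝔭ⁿ}`."*

Accordingly Theorem A is assembled here, sorry-free, from the two halves of the paper, vendored
as named facts for the curves `E_K` of level 1 and transcribed to rational primes (the tree's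
`Ш(E/K) = WeierstrassCurve.sha` is an abelian group, without its `𝓞_K`-module structure; for a
rational prime `p` with `p𝓞_K = 𝔭𝔭̄`, `𝔭²` or `𝔭` one has `Ш[p] = 0 ⇔ Ш_𝔭 = Ш_𝔭̄ = 0` and
`Ш[p^∞] = Ш_{𝔭^∞} + Ш_{𝔭̄^∞}`):

* `Rubin1987_sha_torsionBy_eq_bot_cofinite` — **Theorem 6.6** (p. 541: *"Suppose `𝔭 ∤ w_K` and
  `𝒴 ≢ 0 (mod 𝔭)`. Then `Ш_𝔭 = 0`"*, `𝒴 = #E(K)_tors · L(ψ̄,1)/Ω ∈ K`, §5), in the form "if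
  `L(E_K/K, 1) ≠ 0` then `Ш(E_K/K)[p] = 0` for all rational primes `p` outside a finite set"
  (`L(E/K,1) = L(ψ,1)L(ψ̄,1) ≠ 0` makes `𝒴 ≠ 0`, and a non-zero element of `K` is a `𝔭`-unit for
  almost all `𝔭`); this is the half the introduction singles out (p. 529: *"The reader interested
  only in a proof of the statement 'if `L(E/K,1) ≠ 0` then `Ш_𝔭 = 0` for almost all `𝔭`' need
  only read §§1, 2, 3, 5, and 6"*);
* `Rubin1987_sha_primary_finite` — the conclusion of **§10** quoted above (Theorems 1.9, 6.1, 8.1,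
  9.1 and Lemma 2.2 with (1.2)): if `L(E_K/K, 1) ≠ 0` then `Ш(E_K/K)[p^∞]` is finite for every
  rational prime `p`;

and the generic, **proved** inputs of `ShaTorsion.lean`: `Ш(E/K)` is a torsion group
(`WeierstrassCurve.isTorsion_sha`, from the compactness of `Γ_K`) and a torsion abelian group with
finite primary parts, almost all without `p`-torsion, is finite
(`WeierstrassCurve.shaFinite_of_primary`).

* `Rubin1987_shaFinite_baseChange_cmField_of_level2` (**proved**): the two level-2 facts ⇒
  Theorem A for `E_K` (level-1 leaf);
* `shaFinite_of_hasCM_of_L_one_ne_zero_of_level2` (**proved**): … ⇒ bsd.S28 (`Ш` part), with the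
  other level-1 leaves (Deuring, modularity, Silverman's Exercise 2.12(b), Knapp 11.67, Milne
  I.7.1(b)).

The next level would need the objects of §1 (the relaxed Selmer groups `S'(𝔭ⁿ)`, the fields
`K_n = K(E_{𝔭ⁿ})`, ideal class groups `A_n`, local units modulo elliptic units `𝔅_n`), none of
which exists in the tree or in Mathlib v4.32.0.

## References

* K. Rubin, *Tate–Shafarevich groups and L-functions of elliptic curves with complex
  multiplication*, Invent. Math. 89 (1987): Thm. A and Remark (3) (pp. 527–528), §1 (notation
  `M_𝔞`, (1.1), (1.2), Thm. 1.9), §5 (`𝒴`), Thm. 6.6 (p. 541), §10 (pp. 548–549). [Rubin1987Sha]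
* J.-P. Serre, *Galois Cohomology* (1997), I.§2.2 Cor. 3 (through `ShaTorsion.lean`).
  [SerreGaloisCohomology1997]
-/

noncomputable section

open scoped Classical

open WeierstrassCurve

namespace Literature.NumberTheory.EllipticCurves

/-! ### Level-2 named facts (Rubin 1987, Thm. 6.6 and §10) -/

/-- **Rubin 1987, Theorem 6.6, for `E_K` and rational primes.** Printed (Invent. Math. 89 (1987),
p. 541; `E/K` with CM by `𝓞_K`, `𝔭` a prime of `K`, `w_K = #𝓞_K^×`,
`𝒴 = #(E(K)_tors) · L(ψ̄, 1)/Ω ∈ K` as in §5): *"Suppose `𝔭 ∤ w_K` and `𝒴 ≢ 0 (mod 𝔭)`. Then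
`Ш_𝔭 = 0`"* (`Ш_𝔭` the `𝔭`-torsion of `Ш = Ш(E/K)`, §1); equivalently the second assertion of
Theorem A. If `L(E/K, 1) = L(ψ,1)L(ψ̄,1) ≠ 0` ((0.1)) then `𝒴 ≠ 0`, so the hypothesis holds for
all but finitely many `𝔭`, and for a rational prime `p` with `Ш_𝔭 = 0` for all `𝔭 ∣ p` one has
`Ш[p] = 0` (`p𝓞_K = 𝔭𝔭̄`, `𝔭²` or `𝔭`). Vendored in that form ("`Ш_𝔭 = 0` for almost all
`𝔭`", the statement singled out on p. 529) for the curves of level 1: `E = E_K = W.baseChange K`,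
`W/ℚ` with `W.j ∈ maximalCMJInvariants`, `K` a number field with `IsCMFieldOfJ K W.j`,
`L(E_K/K,1) = (W.baseChange K).entireLFunction 1`, `Ш(E_K/K) = (W.baseChange K).sha`.
[cite: Rubin1987Sha, Thm. 6.6 (p. 541), with Thm. A (second assertion) and (0.1), p. 527] -/
def Rubin1987_sha_torsionBy_eq_bot_cofinite : Prop :=
  ∀ (W : WeierstrassCurve ℚ) [W.IsElliptic], W.j ∈ maximalCMJInvariants →
    ∀ (K : Type) [Field K] [NumberField K], IsCMFieldOfJ K W.j →
      (W.baseChange K).entireLFunction 1 ≠ 0 →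
        ∃ S : Finset ℕ, ∀ p : ℕ, p.Prime → p ∉ S →
          ∀ c : (W.baseChange K).sha, p • c = 0 → c = 0

/-- **Rubin 1987, §10: `Ш(E/K)_{𝔭^∞}` is finite for every `𝔭` when `L(E/K, 1) ≠ 0`**, for `E_K`
and rational primes. Printed (Invent. Math. 89 (1987), proof of Theorem A, §10, p. 549; `E/K`
with CM by `𝓞_K`): *"we only need to show that if `L(ψ̄, 1) ≠ 0` then `Ш_{𝔭^∞}` is finite for
every `𝔭`"*, which the paragraph then establishes from Theorem 6.1 (elliptic units and
`L(ψ̄,1)`, bounding `𝔅_n`), Theorems 8.1/9.1 (bounding `Hom(A_n, E_{𝔭ⁿ})^{G_n}`), Theorem 1.9 and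
Lemma 2.2 (the descent: bounded exponent of `S'(𝔭ⁿ)`) and (1.2) (`S(𝔭ⁿ) ↠ Ш_{𝔭ⁿ}`). For a
rational prime `p`, `Ш[p^∞] = Σ_{𝔭 ∣ p} Ш_{𝔭^∞}` is then finite. Vendored in that form for the
curves of level 1 (`E = E_K = W.baseChange K` as in `Rubin1987_sha_torsionBy_eq_bot_cofinite`;
`L(ψ̄,1) ≠ 0 ⇔ L(E/K,1) ≠ 0` by (0.1)).
[cite: Rubin1987Sha, §10, proof of Thm. A, p. 549 (with Thms. 1.9, 6.1, 8.1, 9.1, Lemma 2.2, (1.2))] -/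
def Rubin1987_sha_primary_finite : Prop :=
  ∀ (W : WeierstrassCurve ℚ) [W.IsElliptic], W.j ∈ maximalCMJInvariants →
    ∀ (K : Type) [Field K] [NumberField K], IsCMFieldOfJ K W.j →
      (W.baseChange K).entireLFunction 1 ≠ 0 →
        ∀ p : ℕ, p.Prime → Set.Finite {c : (W.baseChange K).sha | ∃ j : ℕ, p ^ j • c = 0}

/-! ### Assembly -/

/-- **Theorem A for `E_K` from its two halves** (Rubin 1987, §10, first paragraph of the proof,
p. 549): `Ш(E_K/K)` is a torsion group (`WeierstrassCurve.isTorsion_sha`, proved: `Γ_K` is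
compact), its `p`-primary parts are finite (`h10`, §10) and it has no `p`-torsion for almost all
`p` (`h66`, Theorem 6.6), hence it is finite (`WeierstrassCurve.shaFinite_of_primary`, proved).
This discharges the level-1 leaf `Rubin1987_shaFinite_baseChange_cmField` from level 2.
[cite: Rubin1987Sha, §10, p. 549] -/
theorem Rubin1987_shaFinite_baseChange_cmField_of_level2
    (h66 : Rubin1987_sha_torsionBy_eq_bot_cofinite) (h10 : Rubin1987_sha_primary_finite) :
    Rubin1987_shaFinite_baseChange_cmField := by
  intro W _ hj K _ _ hK hL
  exact (W.baseChange K).shaFinite_of_primary (h10 W hj K hK hL) (h66 W hj K hK hL)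

/-- **bsd.S28 (`Ш` part) from level 2.** `shaFinite_of_hasCM_of_L_one_ne_zero` follows,
sorry-free, from Rubin's Theorem 6.6 (`h66`) and §10 (`h10`) over the CM field, Deuring's theorem
(`hD`), modularity (`hmod`), Silverman *Advanced Topics* Exercise 2.12(b) (`hR1`), Knapp 11.67
(`hR2`) and Milne *ADT* I.7.1(b) (`hI`), through `Rubin1987_shaFinite_baseChange_cmField_of_level2`
and the level-1 assembly `shaFinite_of_hasCM_of_L_one_ne_zero_of_printed_sources`.
[cite: Rubin1987Sha, Thm. A, Thm. 6.6, §10 and §0 Remark (3)] -/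
theorem shaFinite_of_hasCM_of_L_one_ne_zero_of_level2
    (h66 : Rubin1987_sha_torsionBy_eq_bot_cofinite) (h10 : Rubin1987_sha_primary_finite)
    (hD : Deuring_LFunction_baseChange_cmField) (hmod : hasEntireLFunction_rat)
    (hR1 : exists_isIsogenous_j_mem_maximalCMJInvariants_of_hasCM)
    (hR2 : LFunction_eq_of_isIsogenous) (hI : shaFinite_iff_of_isIsogenous) :
    shaFinite_of_hasCM_of_L_one_ne_zero :=
  shaFinite_of_hasCM_of_L_one_ne_zero_of_printed_sources
    (Rubin1987_shaFinite_baseChange_cmField_of_level2 h66 h10) hD hmod hR1 hR2 hI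

end Literature.NumberTheory.EllipticCurves

end
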